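import Literature.MathematicalPhysics.QuantumFieldTheory.Balaban1983to89.B8Prop5Reality
import Literature.MathematicalPhysics.QuantumFieldTheory.Balaban1983to89.B8Eq138LandauZd

/-!
# `Balaban1983to89.B8Prop5GaugeParamKLevel` — T. Bałaban, *Spaces of regular gauge field configurations on a lattice and gauge fixing
# conditions*, Commun. Math. Phys. **99** (1985) 75–102 [Balaban1985RegularSpaces] ("B8"), Sect. D pp. 93–94: THE GAUGE PARAMETER `λ′` OF
# PROPOSITION 5 AT `k` LEVELS — the contraction of `B8Prop5ContractionKLevel` INSTANTIATED at `λ′ = λ + H_c(λ)` (Sect. E's change of variables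
# (1.113) in the INVERSION reading (a″) of the owner's ORDER ruling), with the sizes and moduli of `λ′`, `Dλ′`, `ΔH_c` DISCHARGED from the
# displayed bounds of the correction `H_c` ((1.92) for `H′` × Sect. E's bound on `D′`), and the OUTPUT in the shape the Theorem-4 knit
# consumes: `λ′` as a point of the λ-space of norm `≤ α₄` ((1.108)), Hermitian, `= 0` off `Ω₀`, with the Neumann identity at `λ′`

statement-level skeleton of published theorems with citation tags; proofs where landed; nothing here is a claim about the
Yang–Mills mass gap

PDF held: `paper:balaban1985-cmp99-regular-spaces-gauge-fixing` (journal page = PDF page + 74); pp. 91–96.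

WHY THIS FILE (cell `pub-ymgap`, HUMAN RULING D-0062, REBALANCE №41-b; seat `pub-ymgap-dag-n19-b` g2; «JOIN-A» of the CUT-3 assembly).
`B8Prop5ContractionKLevel.propFive_fixedPoint_kLevel` (p427909) produces the fixed point of (1.100) for a DISPLAYED gauge-parameter map `gpar`
and linearisation defect `Eterm`; `B8Prop5Reality` (p428797) makes it Hermitian.  Under the ORDER ruling (a″) of `pub-ymgap-dag-n05-a`
(INBOX l.11309: INVERSION — the Sect. E clause is run on the inverse pair `(e^{−iλ′}, u₁⁻¹)`, the Landau clause at `λ′`, no conjugation), the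
gauge parameter is `λ′ = λ + H_c(λ)` with `H_c(λ) = H′D′(u₁⁻¹, −λ)` — a correction with the (1.92)-type sizes of `H′X` times Sect. E's
`|D′| ≤ C′₂(α₃ + α₄)α₄` and its Lipschitz modulus (`pub-ymgap-dag-n05-b`: `B8SectEKLevelDomainSeq.exists_Dprime_kLevel_of_domainSeq`,
`B8DprimeKLevelLipschitz.Dprime_lipschitz_kLevel`).  This file takes `H_c` as ONE displayed map with those sizes (`h₀`, `h₁`, `h₂`) and moduli
(`l₀`, `l₁`, `l₂`), discharges the nine hypotheses `hg0`/`hg1`/`hgL`/`hE0`/`hEL`/`hgsa`/`hEsa` of the contraction and of the reality transfer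
at `gpar λ := λ + H_c λ`, `Eterm λ := ΔH_c λ`, and delivers the gauge parameter in the consumer's currency (`pub-ymgap-dag-n04-b`
`B8Thm4ExistsModHFP.hFP_of_lamSubK`: a `lamSubK` point of norm `≤ α₄`, Hermitian, supported on `Ω₀`).  «JOIN-B» (the multiplier clause via
`B8Prop5KLevelLetters.multiplier_iff_of_whyZ` + the projection law, and (1.29) via (1.114) + `B8Restr129Inversion`) is the next file.

WHAT THIS FILE PROVES (kernel, 0 sorry, theorems only; `𝔸` a nontrivial C⋆-algebra).
* §1 the instantiation lemmas: `gpar_size`, `gpar_grad`, `gpar_lip`, `eterm_selfAdjoint`, … — the contraction's displayed hypotheses on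
  `gpar λ = λ + H_c λ`, `Eterm λ = ΔH_c λ` from those on `H_c` (with `a₁ = ¼α₄ + h₀`, `b₁ = ¼α₄ + h₁`, `ℓ₀ = 1 + l₀`, `ℓ₁ = 1 + l₁`,
  `m_E = h₂`, `K_E = l₂`); the backward derivative read through the forward one at the shifted bond (unitary `U₀`).
* §2 **`gaugeParam_kLevel`** — THE GAUGE PARAMETER OF PROPOSITION 5 AT `k` LEVELS: under the letters `G′` ((1.101), additive, Dirichlet
  range, Hermitian-preserving), `R` ((1.98)R, additive, Hermitian-preserving on the `Ω_j`), the correction `H_c` (sizes/moduli/reality/support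
  as displayed), the datum `D*A`, `A` ((1.69)-type sizes, Hermitian) at a unitary background `U₀`, bond sets `Eb j ⊇` both bonds at every site of
  `Ω_j`, the windows and the two smallness conditions of the contraction, and `h₀, h₁ ≤ ¾α₄`: THERE ARE `s` (the fixed point of (1.100),
  `‖s‖ ≤ ¼α₄`, `λ_s = G′(Ψλ_s)`) AND `s′` IN THE λ-SPACE WITH `λ_{s′} = λ_s + H_c(λ_s)` (the gauge parameter), `‖s′‖ ≤ α₄` ((1.108)),
  `λ_{s′}` HERMITIAN, `λ_{s′} = 0` OFF `Ω₀`, AND THE NEUMANN IDENTITY `Z + V_{λ′}(RZ) = W_{λ′}` ON EVERY `Ω_j`.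

HONEST SCOPE.  Instantiation bookkeeping over the two landed modules; the letters, `H_c`'s sizes (= (1.92) × Sect. E) and the datum's sizes are
displayed hypotheses; the multiplier clause and (1.29) are NOT here (JOIN-B).  Count-neutral; N05 NOT discharged; nothing continuum / ℝ⁴ / OS /
mass-gap / Clay.  Unit `pub-ymgap-dag-n19-b` (g2), 2026-08-26.  Tree API by name only, nothing restated.
-/

noncomputable section

open NormedSpace Metric Set Filter Topology
open Complex (I)

namespace Literature.MathematicalPhysics.QuantumFieldTheory.Balaban1983to89.B8Prop5GaugeParamKLevel

open B7Prop1Explicit (e U1)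
open B7Prop2Explicit (unitaryUnits mem_unitaryUnits unitaryUnits_le_U1)
open B7Eq78Linearization (conjR)
open B8Ineq132 (covDerivFwd covDeriv norm_conjR)
open B8Eq151V2Divergence (covDeriv_eq_neg_conjR_covDerivFwd)
open B8Eq138LandauZd (covLap covDivB)
open B8LambdaSpaceKLevel (wt wt_pos wt_nonneg lamSubK lamOf lamOf_sub norm_lamOf_le weight_mul_norm_covDerivFwd_le mkLam lamOf_mkLam
  norm_mkLam_le norm_le_iff norm_sub_le_iff covDerivFwd_add' covDerivFwd_sub')
open B8Prop5ContractionKLevel (Bd2 Zsol Vop Wsrc PsiP5 Mc Kc mWc KWc propFive_fixedPoint_kLevel propFive_fixedPoint_kLevel_spec covDeriv_sub')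
open B8Prop5Reality (propFive_fixedPoint_kLevel_selfAdjoint isSelfAdjoint_covDerivFwd isSelfAdjoint_covDeriv)

-- `Site` alone could resolve to the torus sites of `Setup.lean`; re-export the `ℤ^d` sites of `B7Prop1Explicit`.
export B7Prop1Explicit (Site)

variable {d : ℕ} {𝔸 : Type*} [CStarAlgebra 𝔸] [Nontrivial 𝔸]

/-! ## §1 The displayed hypotheses of the contraction at `gpar λ = λ + H_c λ`, `Eterm λ = ΔH_c λ` -/

section Instantiate

variable {L k : ℕ} {η : ℝ} {Ω : ℕ → Set (Site d)} {Eb : ℕ → Set (Site d × Fin d)} {U₀ : Site d → Fin d → 𝔸ˣ}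

/-- The backward covariant difference read through the forward one at the shifted bond, at a unitary background:
`‖D*_μf(x)‖ = ‖D_μf(x − e_μ)‖`. [cite: Balaban1985RegularSpaces, (1.1) p.76] -/
theorem norm_covDeriv_eq (hU₀ : ∀ x κ, U₀ x κ ∈ unitaryUnits 𝔸) (η : ℝ) (μ : Fin d) (f : Site d → 𝔸) (x : Site d) :
    ‖covDeriv η U₀ μ f x‖ = ‖covDerivFwd η U₀ μ f (x - e μ)‖ := by
  rw [covDeriv_eq_neg_conjR_covDerivFwd, norm_neg, norm_conjR ((U1 𝔸).inv_mem (unitaryUnits_le_U1 (hU₀ _ μ)))]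

omit [Nontrivial 𝔸] in
/-- **(hg0) the size of `λ′ = λ + H_c λ`**: `‖λ′(x)‖ ≤ ¼α₄ + h₀` on the ball. [cite: Balaban1985RegularSpaces, (1.120) p.96, (1.108) p.94] -/
theorem gpar_size {Hc : (Site d → 𝔸) → (Site d → 𝔸)} {α₄ h₀ : ℝ} (hc0 : ∀ s : lamSubK η U₀ L k Eb, ‖s‖ ≤ α₄ / 4 → ∀ x, ‖Hc (lamOf s) x‖ ≤ h₀)
    (s : lamSubK η U₀ L k Eb) (hs : ‖s‖ ≤ α₄ / 4) (x : Site d) : ‖(lamOf s + Hc (lamOf s)) x‖ ≤ α₄ / 4 + h₀ := by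
  rw [Pi.add_apply]
  exact (norm_add_le _ _).trans (add_le_add ((norm_lamOf_le s x).trans hs) (hc0 s hs x))

/-- **(hg1) the gradient of `λ′`** at the sites of `Ω_j`, both directions: `(Lʲη)‖D_μλ′‖, (Lʲη)‖D*_μλ′‖ ≤ ¼α₄ + h₁` (the backward one through the
forward one at the shifted bond, which is a bond of `Ω_j`: `hEbΩ`). [cite: Balaban1985RegularSpaces, (1.120) p.96, (1.108) p.94] -/
theorem gpar_grad (hη : 0 < η) (hU₀ : ∀ x κ, U₀ x κ ∈ unitaryUnits 𝔸)
    (hEbΩ : ∀ j, j ≤ k → ∀ x ∈ Ω j, ∀ μ : Fin d, (x, μ) ∈ Eb j ∧ (x - e μ, μ) ∈ Eb j)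
    {Hc : (Site d → 𝔸) → (Site d → 𝔸)} {α₄ h₁ : ℝ}
    (hc1 : ∀ s : lamSubK η U₀ L k Eb, ‖s‖ ≤ α₄ / 4 → ∀ j, j ≤ k → ∀ p ∈ Eb j, wt L η j * ‖covDerivFwd η U₀ p.2 (Hc (lamOf s)) p.1‖ ≤ h₁)
    (s : lamSubK η U₀ L k Eb) (hs : ‖s‖ ≤ α₄ / 4) {j : ℕ} (hj : j ≤ k) {x : Site d} (hx : x ∈ Ω j) (μ : Fin d) :
    wt L η j * ‖covDerivFwd η U₀ μ (lamOf s + Hc (lamOf s)) x‖ ≤ α₄ / 4 + h₁ ∧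
      wt L η j * ‖covDeriv η U₀ μ (lamOf s + Hc (lamOf s)) x‖ ≤ α₄ / 4 + h₁ := by
  have hw : 0 ≤ wt L η j := wt_nonneg L hη.le j
  have key : ∀ y : Site d, (y, μ) ∈ Eb j → wt L η j * ‖covDerivFwd η U₀ μ (lamOf s + Hc (lamOf s)) y‖ ≤ α₄ / 4 + h₁ := by
    intro y hy
    rw [covDerivFwd_add']
    calc wt L η j * ‖covDerivFwd η U₀ μ (lamOf s) y + covDerivFwd η U₀ μ (Hc (lamOf s)) y‖
        ≤ wt L η j * (‖covDerivFwd η U₀ μ (lamOf s) y‖ + ‖covDerivFwd η U₀ μ (Hc (lamOf s)) y‖) := mul_le_mul_of_nonneg_left (norm_add_le _ _) hw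
      _ ≤ α₄ / 4 + h₁ := by
          rw [mul_add]
          exact add_le_add ((weight_mul_norm_covDerivFwd_le hη.le s hj hy).trans hs) (hc1 s hs j hj (y, μ) hy)
  refine ⟨key x (hEbΩ j hj x hx μ).1, ?_⟩
  rw [norm_covDeriv_eq hU₀]
  exact key (x - e μ) (hEbΩ j hj x hx μ).2

/-- **(hgL) the moduli of `λ′`**: `‖λ′_s(x) − λ′_t(x)‖ ≤ (1 + l₀)‖s − t‖` and `(Lʲη)‖D_μ(λ′_s − λ′_t)‖, (Lʲη)‖D*_μ(λ′_s − λ′_t)‖ ≤ (1 + l₁)‖s − t‖` on the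
sites of `Ω_j`. [cite: Balaban1985RegularSpaces, (1.104)–(1.106) p.94] -/
theorem gpar_lip (hη : 0 < η) (hU₀ : ∀ x κ, U₀ x κ ∈ unitaryUnits 𝔸)
    (hEbΩ : ∀ j, j ≤ k → ∀ x ∈ Ω j, ∀ μ : Fin d, (x, μ) ∈ Eb j ∧ (x - e μ, μ) ∈ Eb j)
    {Hc : (Site d → 𝔸) → (Site d → 𝔸)} {α₄ l₀ l₁ : ℝ}
    (hcL0 : ∀ s t : lamSubK η U₀ L k Eb, ‖s‖ ≤ α₄ / 4 → ‖t‖ ≤ α₄ / 4 → ∀ x, ‖Hc (lamOf s) x - Hc (lamOf t) x‖ ≤ l₀ * ‖s - t‖)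
    (hcL1 : ∀ s t : lamSubK η U₀ L k Eb, ‖s‖ ≤ α₄ / 4 → ‖t‖ ≤ α₄ / 4 → ∀ j, j ≤ k → ∀ p ∈ Eb j,
      wt L η j * ‖covDerivFwd η U₀ p.2 (Hc (lamOf s) - Hc (lamOf t)) p.1‖ ≤ l₁ * ‖s - t‖)
    (s t : lamSubK η U₀ L k Eb) (hs : ‖s‖ ≤ α₄ / 4) (ht : ‖t‖ ≤ α₄ / 4) {j : ℕ} (hj : j ≤ k) {x : Site d} (hx : x ∈ Ω j) :
    ‖(lamOf s + Hc (lamOf s)) x - (lamOf t + Hc (lamOf t)) x‖ ≤ (1 + l₀) * ‖s - t‖ ∧ ∀ μ : Fin d,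
      wt L η j * ‖covDerivFwd η U₀ μ ((lamOf s + Hc (lamOf s)) - (lamOf t + Hc (lamOf t))) x‖ ≤ (1 + l₁) * ‖s - t‖ ∧
      wt L η j * ‖covDeriv η U₀ μ ((lamOf s + Hc (lamOf s)) - (lamOf t + Hc (lamOf t))) x‖ ≤ (1 + l₁) * ‖s - t‖ := by
  have hw : 0 ≤ wt L η j := wt_nonneg L hη.le j
  have hδ := (norm_sub_le_iff hη.le s t (norm_nonneg (s - t))).1 le_rfl
  have hfun : (lamOf s + Hc (lamOf s)) - (lamOf t + Hc (lamOf t)) = (lamOf s - lamOf t) + (Hc (lamOf s) - Hc (lamOf t)) := by abel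
  refine ⟨?_, fun μ => ?_⟩
  · rw [Pi.add_apply, Pi.add_apply]
    calc ‖lamOf s x + Hc (lamOf s) x - (lamOf t x + Hc (lamOf t) x)‖
        = ‖(lamOf s x - lamOf t x) + (Hc (lamOf s) x - Hc (lamOf t) x)‖ := by congr 1; abel
      _ ≤ ‖lamOf s x - lamOf t x‖ + ‖Hc (lamOf s) x - Hc (lamOf t) x‖ := norm_add_le _ _
      _ ≤ ‖s - t‖ + l₀ * ‖s - t‖ := add_le_add (hδ.1 x) (hcL0 s t hs ht x)
      _ = (1 + l₀) * ‖s - t‖ := by ring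
  · have key : ∀ y : Site d, (y, μ) ∈ Eb j →
        wt L η j * ‖covDerivFwd η U₀ μ ((lamOf s + Hc (lamOf s)) - (lamOf t + Hc (lamOf t))) y‖ ≤ (1 + l₁) * ‖s - t‖ := by
      intro y hy
      rw [hfun, covDerivFwd_add']
      calc wt L η j * ‖covDerivFwd η U₀ μ (lamOf s - lamOf t) y + covDerivFwd η U₀ μ (Hc (lamOf s) - Hc (lamOf t)) y‖
          ≤ wt L η j * (‖covDerivFwd η U₀ μ (lamOf s - lamOf t) y‖ + ‖covDerivFwd η U₀ μ (Hc (lamOf s) - Hc (lamOf t)) y‖) :=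
            mul_le_mul_of_nonneg_left (norm_add_le _ _) hw
        _ ≤ ‖s - t‖ + l₁ * ‖s - t‖ := by
            rw [mul_add]; exact add_le_add (hδ.2 j hj (y, μ) hy) (hcL1 s t hs ht j hj (y, μ) hy)
        _ = (1 + l₁) * ‖s - t‖ := by ring
    refine ⟨key x (hEbΩ j hj x hx μ).1, ?_⟩
    rw [norm_covDeriv_eq hU₀]
    exact key (x - e μ) (hEbΩ j hj x hx μ).2

omit [Nontrivial 𝔸] in
/-- The covariant Laplacian of a Hermitian configuration at a unitary background is Hermitian. [cite: Balaban1985RegularSpaces, (1.1) p.76] -/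
theorem isSelfAdjoint_covLap (hU₀ : ∀ x κ, U₀ x κ ∈ unitaryUnits 𝔸) {f : Site d → 𝔸} (hf : ∀ x, IsSelfAdjoint (f x)) (x : Site d) :
    IsSelfAdjoint (covLap η U₀ f x) := by
  unfold covLap covDivB
  refine isSelfAdjoint_sum Finset.univ fun μ _ => ?_
  exact isSelfAdjoint_covDeriv (η := η) hU₀ (fun z => isSelfAdjoint_covDerivFwd (η := η) hU₀ hf μ z) μ x

end Instantiate

/-! ## §2 The gauge parameter `λ′` of Proposition 5 at `k` levels -/

section GaugeParam

variable {L k : ℕ} {η : ℝ} {Ω : ℕ → Set (Site d)} {Eb : ℕ → Set (Site d × Fin d)} {U₀ : Site d → Fin d → 𝔸ˣ}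
  {A : Site d → Fin d → 𝔸} {DA : Site d → 𝔸}

/-- **THE GAUGE PARAMETER OF PROPOSITION 5 AT `k` LEVELS, IN THE CONSUMER'S CURRENCY.**  Letters `G′` (`Gp`: (1.101)-shape bound, additive,
Dirichlet range `hGsupp`, Hermitian-preserving read on the `Ω_j`) and `R` ((1.98)R, additive, Hermitian-preserving on the `Ω_j`); the Sect. E
correction `H_c` (`λ′ = λ + H_c λ`; sizes `h₀`, `h₁`, `h₂` of `H_cλ`, `DH_cλ`, `ΔH_cλ`, moduli `l₀`, `l₁`, `l₂`, Hermitian-preserving, supported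
on `Ω₀` — all on the ¼α₄-ball); the datum `D*A`, `A` (sizes `c_{DA}`, `c_A`, Hermitian) at a unitary `U₀`; bond sets containing both bonds at
each site of `Ω_j`; the windows `¼α₄ + h₀ ≤ 1/24`, `0 < ¼α₄ + h₁ ≤ 1/140`, `c_A ≤ 1/13`, `10(¼α₄ + h₀)B_R ≤ ½`, `h₀, h₁ ≤ ¾α₄`, and the
smallness (1.103)/(1.106) on the explicit `M`, `K`.  CONCLUSION: the fixed point `s` of (1.100) and the gauge parameter `s′` with
`λ_{s′} = λ_s + H_c λ_s`, `‖s′‖ ≤ α₄` ((1.108)), `λ_{s′}` Hermitian and `= 0` off `Ω₀`, the Neumann identity `Z + V_{λ′}(RZ) = W_{λ′}` on every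
`Ω_j`, and `λ_s = G′(R(−Z))`. [cite: Balaban1985RegularSpaces, Prop. 5 (1.107)–(1.108) p.94, (1.100)–(1.103) p.93, (1.113)–(1.120) pp.95–96] -/
theorem gaugeParam_kLevel (hL : 1 ≤ L) (hη : 0 < η) (hU₀ : ∀ x κ, U₀ x κ ∈ unitaryUnits 𝔸)
    (hEbΩ : ∀ j, j ≤ k → ∀ x ∈ Ω j, ∀ μ : Fin d, (x, μ) ∈ Eb j ∧ (x - e μ, μ) ∈ Eb j)
    (Gp R Hc : (Site d → 𝔸) → (Site d → 𝔸))
    {α₄ BG BR h₀ h₁ h₂ l₀ l₁ l₂ cA cDA : ℝ}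
    (hα₄ : 0 ≤ α₄) (hBG : 0 ≤ BG) (hBR : 0 ≤ BR) (hh₀ : 0 ≤ h₀) (hh₂ : 0 ≤ h₂) (hl₀ : 0 ≤ l₀) (hl₁ : 0 ≤ l₁)
    (hl₂ : 0 ≤ l₂) (hcA : 0 ≤ cA) (hcA' : cA ≤ 1 / 13) (hcDA : 0 ≤ cDA)
    (ha₁' : α₄ / 4 + h₀ ≤ 1 / 24) (hb₁' : α₄ / 4 + h₁ ≤ 1 / 140) (hb₁ : 0 < α₄ / 4 + h₁) (hθ : 10 * (α₄ / 4 + h₀) * BR ≤ 1 / 2)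
    (hh₀' : h₀ ≤ 3 * α₄ / 4) (hh₁' : h₁ ≤ 3 * α₄ / 4)
    -- letters
    (hG : ∀ (f : Site d → 𝔸) (m : ℝ), 0 ≤ m → Bd2 L η k Ω f m →
      (∀ x, ‖Gp f x‖ ≤ BG * m) ∧ ∀ j, j ≤ k → ∀ p ∈ Eb j, wt L η j * ‖covDerivFwd η U₀ p.2 (Gp f) p.1‖ ≤ BG * m)
    (hGsub : ∀ f g : Site d → 𝔸, Gp (f - g) = Gp f - Gp g)
    (hGsupp : ∀ (f : Site d → 𝔸) (x : Site d), x ∉ Ω 0 → Gp f x = 0)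
    (hGreal : ∀ f : Site d → 𝔸, (∀ j, j ≤ k → ∀ x ∈ Ω j, IsSelfAdjoint (f x)) → ∀ x, IsSelfAdjoint (Gp f x))
    (hRsub : ∀ f g : Site d → 𝔸, R (f - g) = R f - R g)
    (hRbd : ∀ (f : Site d → 𝔸) (m : ℝ), 0 ≤ m → Bd2 L η k Ω f m → Bd2 L η k Ω (R f) (BR * m))
    (hRreal : ∀ f : Site d → 𝔸, (∀ j, j ≤ k → ∀ x ∈ Ω j, IsSelfAdjoint (f x)) → ∀ j, j ≤ k → ∀ x ∈ Ω j, IsSelfAdjoint (R f x))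
    -- the Sect. E correction `H_c` (λ′ = λ + H_c λ)
    (hc0 : ∀ s : lamSubK η U₀ L k Eb, ‖s‖ ≤ α₄ / 4 → ∀ x, ‖Hc (lamOf s) x‖ ≤ h₀)
    (hc1 : ∀ s : lamSubK η U₀ L k Eb, ‖s‖ ≤ α₄ / 4 → ∀ j, j ≤ k → ∀ p ∈ Eb j, wt L η j * ‖covDerivFwd η U₀ p.2 (Hc (lamOf s)) p.1‖ ≤ h₁)
    (hc2 : ∀ s : lamSubK η U₀ L k Eb, ‖s‖ ≤ α₄ / 4 → Bd2 L η k Ω (covLap η U₀ (Hc (lamOf s))) h₂)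
    (hcL0 : ∀ s t : lamSubK η U₀ L k Eb, ‖s‖ ≤ α₄ / 4 → ‖t‖ ≤ α₄ / 4 → ∀ x, ‖Hc (lamOf s) x - Hc (lamOf t) x‖ ≤ l₀ * ‖s - t‖)
    (hcL1 : ∀ s t : lamSubK η U₀ L k Eb, ‖s‖ ≤ α₄ / 4 → ‖t‖ ≤ α₄ / 4 → ∀ j, j ≤ k → ∀ p ∈ Eb j,
      wt L η j * ‖covDerivFwd η U₀ p.2 (Hc (lamOf s) - Hc (lamOf t)) p.1‖ ≤ l₁ * ‖s - t‖)
    (hcL2 : ∀ s t : lamSubK η U₀ L k Eb, ‖s‖ ≤ α₄ / 4 → ‖t‖ ≤ α₄ / 4 →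
      Bd2 L η k Ω (covLap η U₀ (Hc (lamOf s)) - covLap η U₀ (Hc (lamOf t))) (l₂ * ‖s - t‖))
    (hcsa : ∀ s : lamSubK η U₀ L k Eb, ‖s‖ ≤ α₄ / 4 → (∀ x, IsSelfAdjoint (lamOf s x)) → ∀ x, IsSelfAdjoint (Hc (lamOf s) x))
    (hcsupp : ∀ s : lamSubK η U₀ L k Eb, ‖s‖ ≤ α₄ / 4 → ∀ x, x ∉ Ω 0 → Hc (lamOf s) x = 0)
    -- the datum
    (hDA : Bd2 L η k Ω DA cDA) (hDAsa : ∀ j, j ≤ k → ∀ x ∈ Ω j, IsSelfAdjoint (DA x))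
    (hA : ∀ j, j ≤ k → ∀ x ∈ Ω j, ∀ μ : Fin d,
      wt L η j * ‖A x μ‖ ≤ cA ∧ wt L η j * ‖conjR (U₀ (x - e μ) μ)⁻¹ (A (x - e μ) μ)‖ ≤ cA)
    (hAsa : ∀ x μ, IsSelfAdjoint (A x μ))
    -- smallness (1.103)/(1.106) on the explicit constants of the contraction
    (h103 : BG * Mc d BR (α₄ / 4 + h₁) cA h₂ cDA ≤ α₄ / 4)
    (h106 : BG * Kc d BR (α₄ / 4 + h₁) cA h₂ cDA l₂ (1 + l₀) (1 + l₁) ≤ 1 / 2) :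
    ∃ s s' : lamSubK η U₀ L k Eb,
      ‖s‖ ≤ α₄ / 4 ∧
      lamOf s = Gp (PsiP5 η U₀ A DA R (fun lam => lam + Hc lam) (fun lam => covLap η U₀ (Hc lam)) (lamOf s)) ∧
      lamOf s' = lamOf s + Hc (lamOf s) ∧ ‖s'‖ ≤ α₄ ∧ (∀ x, IsSelfAdjoint (lamOf s' x)) ∧ (∀ x, x ∉ Ω 0 → lamOf s' x = 0) ∧
      (∀ j, j ≤ k → ∀ x ∈ Ω j,
        Zsol (Wsrc η U₀ A DA (lamOf s') (covLap η U₀ (Hc (lamOf s)))) (Vop (lamOf s')) R x +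
          Vop (lamOf s') (R (Zsol (Wsrc η U₀ A DA (lamOf s') (covLap η U₀ (Hc (lamOf s)))) (Vop (lamOf s')) R)) x =
        Wsrc η U₀ A DA (lamOf s') (covLap η U₀ (Hc (lamOf s))) x) := by
  set gpar : (Site d → 𝔸) → (Site d → 𝔸) := fun lam => lam + Hc lam with hgpar
  set Eterm : (Site d → 𝔸) → (Site d → 𝔸) := fun lam => covLap η U₀ (Hc lam) with hEterm
  -- the displayed hypotheses of the contraction at (gpar, Eterm)
  have hg0 : ∀ s : lamSubK η U₀ L k Eb, ‖s‖ ≤ α₄ / 4 → ∀ j, j ≤ k → ∀ x ∈ Ω j, ‖gpar (lamOf s) x‖ ≤ α₄ / 4 + h₀ :=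
    fun s hs j _ x _ => gpar_size hc0 s hs x
  have hg1 : ∀ s : lamSubK η U₀ L k Eb, ‖s‖ ≤ α₄ / 4 → ∀ j, j ≤ k → ∀ x ∈ Ω j, ∀ μ : Fin d,
      wt L η j * ‖covDerivFwd η U₀ μ (gpar (lamOf s)) x‖ ≤ α₄ / 4 + h₁ ∧ wt L η j * ‖covDeriv η U₀ μ (gpar (lamOf s)) x‖ ≤ α₄ / 4 + h₁ :=
    fun s hs j hj x hx μ => gpar_grad hη hU₀ hEbΩ hc1 s hs hj hx μ
  have hgL : ∀ s t : lamSubK η U₀ L k Eb, ‖s‖ ≤ α₄ / 4 → ‖t‖ ≤ α₄ / 4 → ∀ j, j ≤ k → ∀ x ∈ Ω j,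
      ‖gpar (lamOf s) x - gpar (lamOf t) x‖ ≤ (1 + l₀) * ‖s - t‖ ∧ ∀ μ : Fin d,
        wt L η j * ‖covDerivFwd η U₀ μ (gpar (lamOf s) - gpar (lamOf t)) x‖ ≤ (1 + l₁) * ‖s - t‖ ∧
        wt L η j * ‖covDeriv η U₀ μ (gpar (lamOf s) - gpar (lamOf t)) x‖ ≤ (1 + l₁) * ‖s - t‖ :=
    fun s t hs ht j hj x hx => gpar_lip hη hU₀ hEbΩ hcL0 hcL1 s t hs ht hj hx
  have hE0 : ∀ s : lamSubK η U₀ L k Eb, ‖s‖ ≤ α₄ / 4 → Bd2 L η k Ω (Eterm (lamOf s)) h₂ := fun s hs => hc2 s hs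
  have hEL : ∀ s t : lamSubK η U₀ L k Eb, ‖s‖ ≤ α₄ / 4 → ‖t‖ ≤ α₄ / 4 →
      Bd2 L η k Ω (Eterm (lamOf s) - Eterm (lamOf t)) (l₂ * ‖s - t‖) := fun s t hs ht => hcL2 s t hs ht
  -- the fixed point
  obtain ⟨s, ⟨hs, hfix⟩, -⟩ := propFive_fixedPoint_kLevel (Ω := Ω) (Eb := Eb) (U₀ := U₀) (A := A) (DA := DA) hL hη Gp R gpar Eterm hα₄ hBG
    hBR (by positivity) ha₁' hb₁ hb₁' hcA hcA' hcDA hh₂ hl₂ (by positivity) (by positivity) hθ hG hGsub hRsub hRbd hg0 hg1 hgL hE0 hEL hDA hA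
    h103 h106
  obtain ⟨hN, -, -, hoff⟩ := propFive_fixedPoint_kLevel_spec (Ω := Ω) (Eb := Eb) (U₀ := U₀) (A := A) (DA := DA) hL hη Gp R gpar Eterm hBR
    (by positivity) ha₁' hb₁ hb₁' hcA hcA' hcDA hh₂ hθ hG hGsupp hRsub hRbd hg0 hg1 hE0 hDA hA hs hfix
  -- reality
  have hgsa : ∀ t : lamSubK η U₀ L k Eb, ‖t‖ ≤ α₄ / 4 → (∀ x, IsSelfAdjoint (lamOf t x)) → ∀ x, IsSelfAdjoint (gpar (lamOf t) x) :=
    fun t ht hsa x => (hsa x).add (hcsa t ht hsa x)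
  have hEsa : ∀ t : lamSubK η U₀ L k Eb, ‖t‖ ≤ α₄ / 4 → (∀ x, IsSelfAdjoint (lamOf t x)) → ∀ j, j ≤ k → ∀ x ∈ Ω j,
      IsSelfAdjoint (Eterm (lamOf t) x) := fun t ht hsa j _ x _ => isSelfAdjoint_covLap hU₀ (hcsa t ht hsa) x
  have hsa : ∀ x, IsSelfAdjoint (lamOf s x) :=
    propFive_fixedPoint_kLevel_selfAdjoint (Ω := Ω) (Eb := Eb) (U₀ := U₀) (A := A) (DA := DA) hL hη hU₀ Gp R gpar Eterm hα₄ hBG hBR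
      (by positivity) ha₁' hb₁ hb₁' hcA hcA' hcDA hh₂ hl₂ (by positivity) (by positivity) hθ hG hGsub hRsub hRbd hg0 hg1 hgL hE0 hEL hDA hA
      h103 h106 hAsa hDAsa hgsa hEsa hRreal hGreal hs hfix
  -- the gauge parameter as a point of the λ-space
  have hb_lam : ∀ x, ‖gpar (lamOf s) x‖ ≤ α₄ := fun x => by
    have := gpar_size hc0 s hs x; simp only [hgpar] at this ⊢; linarith
  have hb_grad : ∀ j, j ≤ k → ∀ p ∈ Eb j, wt L η j * ‖covDerivFwd η U₀ p.2 (gpar (lamOf s)) p.1‖ ≤ α₄ := by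
    intro j hj p hp
    have hw : 0 ≤ wt L η j := wt_nonneg L hη.le j
    simp only [hgpar]
    rw [covDerivFwd_add']
    calc wt L η j * ‖covDerivFwd η U₀ p.2 (lamOf s) p.1 + covDerivFwd η U₀ p.2 (Hc (lamOf s)) p.1‖
        ≤ wt L η j * (‖covDerivFwd η U₀ p.2 (lamOf s) p.1‖ + ‖covDerivFwd η U₀ p.2 (Hc (lamOf s)) p.1‖) :=
          mul_le_mul_of_nonneg_left (norm_add_le _ _) hw
      _ ≤ α₄ / 4 + h₁ := by rw [mul_add]; exact add_le_add ((weight_mul_norm_covDerivFwd_le hη.le s hj hp).trans hs) (hc1 s hs j hj p hp)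
      _ ≤ α₄ := by linarith
  set s' : lamSubK η U₀ L k Eb := mkLam hη.le (gpar (lamOf s)) hb_lam hb_grad with hs'def
  have hs'lam : lamOf s' = gpar (lamOf s) := lamOf_mkLam hη.le _ hb_lam hb_grad
  refine ⟨s, s', hs, hfix, hs'lam, ?_, ?_, ?_, ?_⟩
  · exact (norm_mkLam_le hη.le _ hb_lam hb_grad).trans (max_le le_rfl le_rfl)
  · intro x; rw [hs'lam]; exact hgsa s hs hsa x
  · intro x hx
    rw [hs'lam]; simp only [hgpar, Pi.add_apply]
    rw [hoff x hx, hcsupp s hs x hx, add_zero]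
  · intro j hj x hx
    rw [hs'lam]
    exact hN j hj x hx

end GaugeParam

#print axioms gaugeParam_kLevel

end Literature.MathematicalPhysics.QuantumFieldTheory.Balaban1983to89.B8Prop5GaugeParamKLevel

end
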